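import Literature.Analysis.FluidPDE.LeiZhang2011ClassicalSwirlBound
import Literature.Analysis.FluidPDE.AxisymmetricL3Data
import Literature.Analysis.FluidPDE.LerayHopfTenThirds
import Literature.Analysis.FluidPDE.LeiZhang2011ZoomIn
import Literature.Analysis.FluidPDE.SelfSimilarLiouville
import Literature.Analysis.FluidPDE.PeriodicCylinderFrameInversion
import HarnessLib

/-!
# The swirl is bounded in a tube around the axis near the final time — hypothesis (H1) of the
# localized blow-up argument, for axisymmetric Leray–Hopf solutions classical below the final time

Analysis/FluidPDE proofs-layer file on the discharge path of
`Literature.Analysis.FluidPDE.LeiZhang2011_regularity_bmoStream` (Lei–Zhang 2011, Thm. 1.4).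
In the printed proof `Γ = r v^θ` is bounded "by the assumption on initial value and the maximum
principle" (arXiv p. 12); for a Leray–Hopf solution through a potential singular time the tree
uses instead the **local** maximum estimate (2.6) of the paper's §2, whose constant depends only
on the `BMO` bound of the stream function (`LeiZhang2011.abs_swirl_le_local_of_classical`),
started at the energy exponent `10/3` (`IsLerayHopfOn.memLp_tenThirds_uncurry_slab`). Applied on
the cylinders `Q_R(τ, a)` centred at the axis points `a = x₃ e₃`, `τ ↑ T`, whose `L^{10/3}` norm
of `Γ` is bounded by `R ‖u‖_{L^{10/3}((0,T) × ℝ³)}` uniformly in `a` (translation invariance of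
the Lebesgue measure), it bounds `Γ` on the whole tube `{r(x) ≤ R/4}` for `t ∈ (T − R²/4, T)`.

* `AxisymmetricL3Hyp.swirl_bounded_tube` — (H1): under `AxisymmetricL3Hyp 1 T u p` with a stream
  function with `BMO` slices on `(0, T)`, there are `T₁ < T`, `ρ > 0`, `C₁` with
  `|Γ(t, x)| ≤ C₁` for `t ∈ (T₁, T)`, `r(x) ≤ ρ`.

## References

* Z. Lei, Q. S. Zhang, J. Funct. Anal. 261 (2011) = arXiv:1011.5066, §2 (2.6) and §4 (proof of
  Thm. 1.4, p. 12). [LeiZhang2011]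
-/

noncomputable section

open MeasureTheory Set Function Filter Topology TopologicalSpace Metric
open scoped NNReal ENNReal

namespace Literature.Analysis.FluidPDE

open Literature.Analysis.FunctionSpaces SereginSverak2009

/-- Local notation for physical space `ℝ³ = EuclideanSpace ℝ (Fin 3)`. -/
local notation "ℝ³" => EuclideanSpace ℝ (Fin 3)

/-! ### The `L^{10/3}` mass of `Γ` on axis-centred cylinders -/

/-- **`∫∫_{(τ−R², τ] × B̄(0,R)} |Γ_a|^{10/3} ≤ R^{10/3} ∫∫_{(0,T) × ℝ³} |u|^{10/3}`** for the
translate `u_a(t, y) = u(t, a e₃ + y)` along the axis, `0 ≤ τ − R²`, `τ < T`: on the cylinder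
`|Γ_a(t, y)| ≤ r(y) |u(t, a e₃ + y)| ≤ R |u(t, a e₃ + y)|`, Tonelli's inequality, and the
translation invariance of the Lebesgue measure. [folklore] -/
theorem lintegral_cylinder_swirl_translate_le {T : ℝ} {u : ℝ → ℝ³ → ℝ³}
    (hum : AEStronglyMeasurable (uncurry u)
      ((volume : Measure (ℝ × ℝ³)).restrict (Ioo 0 T ×ˢ univ)))
    (a : ℝ) {τ R : ℝ} (hR : 0 ≤ R) (h0 : 0 ≤ τ - R ^ 2) (hτ : τ < T) :
    ∫⁻ q in Ioc (τ - R ^ 2) τ ×ˢ closedBall (0 : ℝ³) R,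
        ‖|swirl (fun y => u q.1 (a • eZ + y)) q.2|‖ₑ ^ (10 / 3 : ℝ)
          ∂((volume : Measure ℝ).prod (volume : Measure ℝ³)) ≤
      ENNReal.ofReal R ^ (10 / 3 : ℝ) *
        ∫⁻ z in Ioo 0 T ×ˢ (univ : Set ℝ³), ‖u z.1 z.2‖ₑ ^ (10 / 3 : ℝ) := by
  have hp : (0 : ℝ) ≤ 10 / 3 := by norm_num
  -- pointwise bound on the cylinder
  have hpt : ∀ q ∈ Ioc (τ - R ^ 2) τ ×ˢ closedBall (0 : ℝ³) R,
      ‖|swirl (fun y => u q.1 (a • eZ + y)) q.2|‖ₑ ^ (10 / 3 : ℝ) ≤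
        ENNReal.ofReal R ^ (10 / 3 : ℝ) * ‖u q.1 (a • eZ + q.2)‖ₑ ^ (10 / 3 : ℝ) := by
    rintro ⟨t, y⟩ ⟨-, hy⟩
    have hy' : ‖y‖ ≤ R := by simpa [mem_closedBall, dist_zero_right] using hy
    have h1 : |swirl (fun y => u t (a • eZ + y)) y| ≤ R * ‖u t (a • eZ + y)‖ :=
      (abs_swirl_le_cylRadius_mul_norm (fun y => u t (a • eZ + y)) y).trans
        (mul_le_mul_of_nonneg_right ((cylRadius_le_norm y).trans hy') (norm_nonneg _))
    have h2 : ‖|swirl (fun y => u t (a • eZ + y)) y|‖ₑ ≤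
        ENNReal.ofReal R * ‖u t (a • eZ + y)‖ₑ := by
      rw [Real.enorm_eq_ofReal (abs_nonneg _), ← ofReal_norm, ← ENNReal.ofReal_mul hR]
      exact ENNReal.ofReal_le_ofReal h1
    calc ‖|swirl (fun y => u t (a • eZ + y)) y|‖ₑ ^ (10 / 3 : ℝ)
        ≤ (ENNReal.ofReal R * ‖u t (a • eZ + y)‖ₑ) ^ (10 / 3 : ℝ) := ENNReal.rpow_le_rpow h2 hp
      _ = ENNReal.ofReal R ^ (10 / 3 : ℝ) * ‖u t (a • eZ + y)‖ₑ ^ (10 / 3 : ℝ) :=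
          ENNReal.mul_rpow_of_nonneg _ _ hp
  have hmeas : MeasurableSet (Ioc (τ - R ^ 2) τ ×ˢ closedBall (0 : ℝ³) R) :=
    measurableSet_Ioc.prod measurableSet_closedBall
  -- Tonelli's inequality and translation invariance
  have hI : Ioc (τ - R ^ 2) τ ⊆ Ioo 0 T := fun t ht => ⟨h0.trans_lt ht.1, ht.2.trans_lt hτ⟩
  have hum' : AEStronglyMeasurable (uncurry u)
      ((volume.restrict (Ioo 0 T)).prod (volume : Measure ℝ³)) := by
    have e : (volume.restrict (Ioo 0 T)).prod (volume : Measure ℝ³) =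
        (volume : Measure (ℝ × ℝ³)).restrict (Ioo 0 T ×ˢ univ) := by
      rw [Measure.volume_eq_prod, Measure.restrict_prod_eq_prod_univ]
    rw [e]; exact hum
  calc ∫⁻ q in Ioc (τ - R ^ 2) τ ×ˢ closedBall (0 : ℝ³) R,
          ‖|swirl (fun y => u q.1 (a • eZ + y)) q.2|‖ₑ ^ (10 / 3 : ℝ)
            ∂((volume : Measure ℝ).prod (volume : Measure ℝ³))
      ≤ ∫⁻ q in Ioc (τ - R ^ 2) τ ×ˢ closedBall (0 : ℝ³) R,
          ENNReal.ofReal R ^ (10 / 3 : ℝ) * ‖u q.1 (a • eZ + q.2)‖ₑ ^ (10 / 3 : ℝ)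
            ∂((volume : Measure ℝ).prod (volume : Measure ℝ³)) :=
        setLIntegral_mono' hmeas fun q hq => hpt q hq
    _ ≤ ∫⁻ q in Ioc (τ - R ^ 2) τ ×ˢ (univ : Set ℝ³),
          ENNReal.ofReal R ^ (10 / 3 : ℝ) * ‖u q.1 (a • eZ + q.2)‖ₑ ^ (10 / 3 : ℝ)
            ∂((volume : Measure ℝ).prod (volume : Measure ℝ³)) :=
        lintegral_mono_set (prod_mono Subset.rfl (subset_univ _))
    _ = ∫⁻ q, ENNReal.ofReal R ^ (10 / 3 : ℝ) * ‖u q.1 (a • eZ + q.2)‖ₑ ^ (10 / 3 : ℝ)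
            ∂((volume.restrict (Ioc (τ - R ^ 2) τ)).prod (volume : Measure ℝ³)) := by
        rw [Measure.restrict_prod_eq_prod_univ]
    _ ≤ ∫⁻ t in Ioc (τ - R ^ 2) τ, ∫⁻ y,
          ENNReal.ofReal R ^ (10 / 3 : ℝ) * ‖u t (a • eZ + y)‖ₑ ^ (10 / 3 : ℝ) :=
        lintegral_prod_le _
    _ = ∫⁻ t in Ioc (τ - R ^ 2) τ, ENNReal.ofReal R ^ (10 / 3 : ℝ) *
          ∫⁻ y, ‖u t y‖ₑ ^ (10 / 3 : ℝ) := by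
        refine lintegral_congr fun t => ?_
        rw [lintegral_const_mul' _ _ (ENNReal.rpow_ne_top_of_nonneg hp ENNReal.ofReal_ne_top)]
        congr 1
        exact lintegral_add_left_eq_self (fun y => ‖u t y‖ₑ ^ (10 / 3 : ℝ)) (a • eZ)
    _ = ENNReal.ofReal R ^ (10 / 3 : ℝ) *
          ∫⁻ t in Ioc (τ - R ^ 2) τ, ∫⁻ y, ‖u t y‖ₑ ^ (10 / 3 : ℝ) := by
        rw [lintegral_const_mul' _ _ (ENNReal.rpow_ne_top_of_nonneg hp ENNReal.ofReal_ne_top)]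
    _ ≤ ENNReal.ofReal R ^ (10 / 3 : ℝ) *
          ∫⁻ t in Ioo 0 T, ∫⁻ y, ‖u t y‖ₑ ^ (10 / 3 : ℝ) :=
        mul_le_mul_right (lintegral_mono_set hI) _
    _ = ENNReal.ofReal R ^ (10 / 3 : ℝ) *
          ∫⁻ z in Ioo 0 T ×ˢ (univ : Set ℝ³), ‖u z.1 z.2‖ₑ ^ (10 / 3 : ℝ) := by
        congr 1
        have hm : AEMeasurable (fun z : ℝ × ℝ³ => ‖u z.1 z.2‖ₑ ^ (10 / 3 : ℝ))
            ((volume.restrict (Ioo 0 T)).prod (volume : Measure ℝ³)) :=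
          hum'.aemeasurable.enorm.pow_const _
        rw [Measure.volume_eq_prod, ← Measure.restrict_prod_eq_prod_univ, lintegral_prod _ hm]

namespace AxisymmetricL3Hyp

variable {T : ℝ} {u : ℝ → ℝ³ → ℝ³} {p : ℝ → ℝ³ → ℝ}

/-- **(H1): the swirl is bounded in a tube around the axis near the final time.** Under
`AxisymmetricL3Hyp 1 T u p` with a stream function with `BMO` slices on `(0, T)`
(`HasBMOStreamFunctionOn (Ioo 0 T) u B K`) there are `T₁ < T`, `ρ > 0` and `C₁` with
`|Γ(t, x)| ≤ C₁` for all `t ∈ (T₁, T)` and `r(x) ≤ ρ`: the local maximum estimate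
`LeiZhang2011.abs_swirl_le_local_of_classical` (constant depending only on `K`) on the cylinders
`Q_R(τ, x₃ e₃)`, `R = √T/2`, `τ = (t + T)/2`, for the translates `u(·, x₃ e₃ + ·)` (again
classical, axisymmetric, with the translated stream function, bounded on the closed sub-slabs),
whose `L^{10/3}` mass of `Γ` is at most `R^{10/3} ‖u‖_{L^{10/3}((0,T)×ℝ³)}^{10/3} < ∞`
(`lintegral_cylinder_swirl_translate_le`, `IsLerayHopfOn.memLp_tenThirds_uncurry_slab`).
[cite: LeiZhang2011, §2 (2.6) and §4, proof of Thm. 1.4 (arXiv pp. 8, 12)] -/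
theorem swirl_bounded_tube (H : AxisymmetricL3Hyp 1 T u p)
    {B : ℝ → ℝ³ → ℝ³} {K : ℝ≥0} (hB : HasBMOStreamFunctionOn (Ioo 0 T) u B K) :
    ∃ T₁ < T, ∃ ρ > 0, ∃ C₁ : ℝ, ∀ t ∈ Ioo T₁ T, ∀ x : ℝ³, cylRadius x ≤ ρ →
      |swirl (u t) x| ≤ C₁ := by
  have hT := H.time_pos
  obtain ⟨C, hC0, hC⟩ := LeiZhang2011.abs_swirl_le_local_of_classical K
  -- the scale
  set R : ℝ := Real.sqrt T / 2 with hR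
  have hRpos : 0 < R := by positivity
  have hR2 : R ^ 2 = T / 4 := by
    rw [hR, div_pow, Real.sq_sqrt hT.le]; ring
  -- the `L^{10/3}` mass of `u` on the slab
  set Mu : ℝ≥0∞ := ∫⁻ z in Ioo 0 T ×ˢ (univ : Set ℝ³), ‖u z.1 z.2‖ₑ ^ (10 / 3 : ℝ) with hMu
  have hMu_fin : Mu < ∞ := by
    have hmem := H.lerayHopf.memLp_tenThirds_uncurry_slab
    have h := hmem.2
    rw [eLpNorm_lt_top_iff_lintegral_rpow_enorm_lt_top
        (ENNReal.ofReal_pos.2 (by norm_num : (0 : ℝ) < 10 / 3)).ne' ENNReal.ofReal_ne_top,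
      ENNReal.toReal_ofReal (by norm_num : (0 : ℝ) ≤ 10 / 3)] at h
    exact h
  have hum : AEStronglyMeasurable (uncurry u)
      ((volume : Measure (ℝ × ℝ³)).restrict (Ioo 0 T ×ˢ univ)) := H.lerayHopf.weak.1
  -- the constant
  set N : ℝ≥0∞ := (ENNReal.ofReal R ^ (10 / 3 : ℝ) * Mu) ^ (3 / 10 : ℝ) with hN
  have hNfin : N ≠ ∞ := ENNReal.rpow_ne_top_of_nonneg (by norm_num)
    (ENNReal.mul_ne_top (ENNReal.rpow_ne_top_of_nonneg (by norm_num) ENNReal.ofReal_ne_top)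
      hMu_fin.ne)
  refine ⟨T - R ^ 2 / 4, by nlinarith, R / 4, by positivity,
    C * R ^ (-(3 / 2 : ℝ)) * N.toReal, fun t ht x hx => ?_⟩
  -- the top time `τ = (t + T)/2` and the slab `[τ − R², τ] ⊆ (0, T)`
  set τ : ℝ := (t + T) / 2 with hτ
  have hτT : τ < T := by rw [hτ]; linarith [ht.2]
  have htτ : t ∈ Ioo (τ - (R / 2) ^ 2) τ := by
    constructor <;> [skip; (rw [hτ]; linarith [ht.2])]
    rw [hτ]; nlinarith [ht.1]
  have h0τ : 0 < τ - R ^ 2 := by rw [hτ, hR2]; nlinarith [ht.1]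
  have hsub : Icc (τ - R ^ 2) τ ⊆ Ioo 0 T := fun s hs => ⟨h0τ.trans_le hs.1, hs.2.trans_lt hτT⟩
  -- the translate along the axis, in the normalisation of the zoom lemmas (`c = 1`, `t₀ = 0`)
  set V : ℝ → ℝ³ → ℝ³ := (1 : ℝ) • stPull ((1 : ℝ) ^ 2) 1 0 (x 2 • eZ) u with hV
  set P : ℝ → ℝ³ → ℝ := (1 : ℝ) ^ 2 • stPull ((1 : ℝ) ^ 2) 1 0 (x 2 • eZ) p with hP
  have eI : Ioo (-((0 : ℝ) / 1 ^ 2)) ((T - 0) / 1 ^ 2) = Ioo 0 T := by norm_num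
  have hVapp : ∀ s y, V s y = u s (x 2 • eZ + y) := fun s y => by
    rw [hV, smul_stPull_apply]; simp
  have hVcl : IsClassicalNSSolutionOn (Ioo 0 T) 1 0 V P := by
    have h := zoom_isClassicalNSSolutionOn H.classical_Ioo one_pos 0 x
    rwa [eI] at h
  have hVaxi : ∀ s ∈ Ioo 0 T, IsAxisymmetric (V s) := by
    intro s hs
    have hs' : (0 : ℝ) + 1 ^ 2 * s ∈ Ioo 0 T := by simpa using hs
    exact zoom_isAxisymmetric (fun t ht => H.axisymmetric t (Ioo_subset_Ico_self ht)) hs'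
  have hVB : HasBMOStreamFunctionOn (Ioo 0 T) V (stPull ((1 : ℝ) ^ 2) 1 0 (x 2 • eZ) B) K := by
    have h := zoom_hasBMOStreamFunctionOn hB one_ne_zero 0 x
    rwa [eI] at h
  have hVbd : ∃ Cu : ℝ, ∀ s ∈ Icc (τ - R ^ 2) τ, ∀ y, ‖V s y‖ ≤ Cu := by
    obtain ⟨M, hM⟩ := H.bounded_subslab τ hτT
    exact ⟨M, fun s hs y => by rw [hVapp]; exact hM s ⟨h0τ.le.trans hs.1, hs.2⟩ _⟩
  -- the local maximum estimate at `(τ, R)`, evaluated at `y = x'` (`x = x₃ e₃ + x'`)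
  have hy : horiz x ∈ ball (0 : ℝ³) (R / 2) := by
    rw [mem_ball, dist_zero_right, norm_horiz]; linarith
  have hloc := hC hVcl hVaxi hVB hRpos hsub hVbd t htτ (horiz x) hy
  have hsw : swirl (V t) (horiz x) = swirl (u t) x := by
    have e : V t = fun y => (1 : ℝ) • u (0 + 1 ^ 2 * t) (x 2 • eZ + (1 : ℝ) • y) := by
      funext y; rw [hV, smul_stPull_apply]
    rw [e, swirl_smul_comp_eZ_smul (u (0 + 1 ^ 2 * t)) 1 (x 2) one_ne_zero, div_one, one_mul]
    have h1 : (0 : ℝ) + 1 ^ 2 * t = t := by ring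
    have h2 : x 2 • eZ + (1 : ℝ) • horiz x = x := by
      rw [one_smul, add_comm]; exact horiz_add_smul_eZ x
    rw [h1, h2]
  rw [hsw] at hloc
  refine hloc.trans ?_
  -- the `L^{10/3}` mass of `Γ` on the cylinder is at most `N`
  have hcyl := lintegral_cylinder_swirl_translate_le hum (x 2) hRpos.le h0τ.le hτT
  have hnorm : eLpNorm (fun q : ℝ × ℝ³ => |swirl (V q.1) q.2|) (ENNReal.ofReal (10 / 3))
      (((volume : Measure ℝ).prod (volume : Measure ℝ³)).restrict
        (Ioc (τ - R ^ 2) τ ×ˢ closedBall (0 : ℝ³) R)) ≤ N := by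
    have e : (fun q : ℝ × ℝ³ => |swirl (V q.1) q.2|) =
        fun q : ℝ × ℝ³ => |swirl (fun y => u q.1 (x 2 • eZ + y)) q.2| := by
      funext q
      have : V q.1 = fun y => u q.1 (x 2 • eZ + y) := funext fun y => hVapp q.1 y
      rw [this]
    rw [e, eLpNorm_eq_lintegral_rpow_enorm_toReal
        (ENNReal.ofReal_pos.2 (by norm_num : (0 : ℝ) < 10 / 3)).ne' ENNReal.ofReal_ne_top,
      ENNReal.toReal_ofReal (by norm_num : (0 : ℝ) ≤ 10 / 3), hN,
      show (1 : ℝ) / (10 / 3) = 3 / 10 by norm_num]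
    exact ENNReal.rpow_le_rpow hcyl (by norm_num)
  have hNle : (eLpNorm (fun q : ℝ × ℝ³ => |swirl (V q.1) q.2|) (ENNReal.ofReal (10 / 3))
      (((volume : Measure ℝ).prod (volume : Measure ℝ³)).restrict
        (Ioc (τ - R ^ 2) τ ×ˢ closedBall (0 : ℝ³) R))).toReal ≤ N.toReal :=
    ENNReal.toReal_mono hNfin hnorm
  have hfac : 0 ≤ C * R ^ (-(3 / 2 : ℝ)) := mul_nonneg hC0 (Real.rpow_nonneg hRpos.le _)
  exact mul_le_mul_of_nonneg_left hNle hfac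

end AxisymmetricL3Hyp

end Literature.Analysis.FluidPDE

end
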